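import Mathlib.Analysis.InnerProductSpace.Projection.Basic
import Mathlib.Analysis.SpecialFunctions.Complex.CircleAddChar
import Mathlib.Analysis.Complex.Circle
import Mathlib.Analysis.RCLike.Lemmas
import Mathlib.Topology.Algebra.Module.FiniteDimension
import Literature.NumberTheory.LFunctions.AutomaticSequenceTransducerArith8
import Literature.NumberTheory.LFunctions.AutomaticSequenceTransducerRelabel
import HarnessLib

/-!
# The contraction step of Müllner's Fourier estimate (Thm. 4.5 / Lemmas 4.8–4.9 of Müllner 2017), proved

Everything in this file is PROVED (plus plain definitions). It is the algebraic heart of §4.1 of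
C. Müllner, *Automatic sequences fulfill the Sarnak conjecture*, Duke Math. J. 166 (2017)
(= arXiv:1602.03042), in a representation-free form that needs neither irreducibility nor the
good labelling of §2: for a base-`k` automaton `δ` (letters `≥ k` trivial) with `d(A) = 1` and
`k₀(A) = 1` (the situation after Prop. 2.25), a relabelling `ρ` of its naturally induced
transducer (`MinImage.Tρ`), and ANY finite-dimensional unitary representation `A` of the ambient
symmetric group `Perm (Fin n₀)` on an inner-product space `V`:

* `MinImage.charSubspace … N ℓ` — the simultaneous eigenspace of the (relabelled) loop outputs at
  the state `N` for the character `D_ℓ(g) = e(ℓ s₀(g)/d')` of Thm. 2.16 (`MinImage.s0`,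
  `AutomaticSequenceTransducerArith6.lean`); `MinImage.badSubspace … N = ⨆_ℓ charSubspace N ℓ`
  (the `D_0, …, D_{d'-1}`-isotypic part of `A|_{G_N}`) and its orthogonal complement
  `MinImage.goodSubspace … N`;
* `MinImage.A_Tρ_mem_charSubspace`, `MinImage.A_Tρ_mem_goodSubspace` — these subspaces are
  carried into each other along every digit path (`s₀` is conjugation-invariant along paths);
* `MinImage.loopBlock k m N` — the `ε < k^m` whose padded block `(ε)_k^m` is a loop at `N`;
* **the contraction** `MinImage.exists_loopSum_contraction` (the inequality
  `‖∑_{g∈G} D(g) e(−[w_g] t)‖ < |G|` of Lemma 4.8 and the two-step estimate of Lemma 4.9, merged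
  into one statement by summing over ALL loops of a fixed length `m`): there are `m ≥ 1` and
  `η > 0` such that for every state `N`, every real `t` and every `y` in the good subspace at `N`,
  `‖∑_{ε ∈ loopBlock k m N} e(−εt) · A(T̄(N,(ε)_k^m)) y‖ ≤ (#loopBlock k m N − η) ‖y‖`.
  Mechanism (Müllner pp. 20–22): equality in the triangle inequality forces a common eigenvector
  `y` with a character `χ(g) = e(([w_g]−[w_id]) t)`; identity loops give `d(q,q)·t ∈ ℤ`
  (`d(q,q) = d'·d''`, Thm. 2.16 (2)); choosing all representatives with a common suffix of length
  `≥ ℓ₀` kills `d'' ∣ k^{ℓ₀}`, and `[w] ≡ s₀(T(q,w)) (mod d')` (`k₀ = 1`) shows `χ = D_ℓ`,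
  contradicting `y ⊥ badSubspace`; compactness in `(t, y)` gives the uniform `η`.

The recursion (Lemma 4.7) and the resulting exponential decay (Prop. 4.6 / Thm. 4.5) are in
`MoebiusAutomaticFourierDecay.lean`.

## References
* C. Müllner, Duke Math. J. 166 (2017) 3219–3290 = arXiv:1602.03042: Thm. 4.5, Prop. 4.6,
  Lemmas 4.8, 4.9 (pp. 19–22), Thm. 2.16 (p. 11). [Mullner2017]
-/

noncomputable section

open Finset Complex
open scoped FourierTransform InnerProductSpace

namespace Literature.NumberTheory.LFunctions

/-! ## Elementary helpers -/

section Helpers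

/-- `e(x) e(y) = e(x + y)` in `ℂ`. [folklore] -/
theorem fourierChar_coe_add (a b : ℝ) : ((𝐞 (a + b) : Circle) : ℂ) = (𝐞 a : ℂ) * (𝐞 b : ℂ) := by
  rw [AddChar.map_add_eq_mul, Circle.coe_mul]

/-- `|e(x)| = 1`. [folklore] -/
theorem norm_fourierChar_coe (x : ℝ) : ‖((𝐞 x : Circle) : ℂ)‖ = 1 := Circle.norm_coe _

/-- `e(n) = 1` for an integer `n`. [folklore] -/
theorem fourierChar_intCast (n : ℤ) : ((𝐞 (n : ℝ) : Circle) : ℂ) = 1 := by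
  rw [Real.fourierChar_apply]
  have : ((2 * Real.pi * (n : ℝ) : ℝ) : ℂ) * I = n * (2 * Real.pi * I) := by push_cast; ring
  rw [this]
  exact Complex.exp_int_mul_two_pi_mul_I n

/-- `e(x) = 1` forces `x ∈ ℤ`. [folklore] -/
theorem exists_int_of_fourierChar_eq_one {x : ℝ} (h : ((𝐞 x : Circle) : ℂ) = 1) : ∃ n : ℤ, x = n := by
  rw [Real.fourierChar_apply, Complex.exp_eq_one_iff] at h
  obtain ⟨n, hn⟩ := h
  refine ⟨n, ?_⟩
  have h2 : (2 * Real.pi * I : ℂ) ≠ 0 := by simp [Real.pi_ne_zero, Complex.I_ne_zero]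
  have e1 : ((x : ℝ) : ℂ) * (2 * Real.pi * I) = (n : ℂ) * (2 * Real.pi * I) := by
    rw [← hn]; push_cast; ring
  exact_mod_cast mul_right_cancel₀ h2 e1

/-- `e` of a rational `z / d` is the standard additive character of `ZMod d` at `z`. [folklore] -/
theorem fourierChar_int_div (d : ℕ) [NeZero d] (z : ℤ) :
    ((𝐞 ((z : ℝ) / d) : Circle) : ℂ) = ZMod.stdAddChar (N := d) (z : ZMod d) := by
  rw [ZMod.stdAddChar_coe, Real.fourierChar_apply]
  congr 1
  push_cast
  ring

/-- **Strictness in the triangle inequality** (inner-product spaces are strictly convex): if the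
vectors `x i`, `i ∈ s`, all have norm `≤ r` and two of them differ, then
`‖∑_{i∈s} x i‖ < #s · r`. [folklore] -/
theorem norm_sum_lt_card_mul_of_ne {ι V : Type*} [NormedAddCommGroup V] [InnerProductSpace ℂ V]
    {s : Finset ι} {x : ι → V} {r : ℝ} (hr : ∀ i ∈ s, ‖x i‖ ≤ r) {i₀ j₀ : ι} (hi₀ : i₀ ∈ s)
    (hj₀ : j₀ ∈ s) (hne : x i₀ ≠ x j₀) : ‖∑ i ∈ s, x i‖ < s.card * r := by
  have hle : ‖∑ i ∈ s, x i‖ ≤ s.card * r :=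
    (norm_sum_le _ _).trans ((sum_le_sum hr).trans (by rw [sum_const, nsmul_eq_mul]))
  refine lt_of_le_of_ne hle fun heq => hne ?_
  set a : V := ∑ i ∈ s, x i with ha
  have hr0 : 0 ≤ r := (norm_nonneg _).trans (hr i₀ hi₀)
  -- all norms equal `r`
  have hnorm : ∀ i ∈ s, ‖x i‖ = r := by
    have h1 : ∑ i ∈ s, ‖x i‖ = ∑ _i ∈ s, r := by
      apply le_antisymm (sum_le_sum hr)
      rw [sum_const, nsmul_eq_mul, ← heq]
      exact norm_sum_le _ _
    exact (sum_eq_sum_iff_of_le hr).1 h1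
  rcases hr0.eq_or_lt with hr0 | hrpos
  · have h0 : ∀ i ∈ s, x i = 0 := fun i hi => by
      have := hnorm i hi; rw [← hr0] at this; exact norm_eq_zero.1 this
    rw [h0 i₀ hi₀, h0 j₀ hj₀]
  -- `Re ⟪x i, a⟫ = r ‖a‖` for every `i`
  have hre : ∀ i ∈ s, (⟪x i, a⟫_ℂ).re = r * ‖a‖ := by
    have hle' : ∀ i ∈ s, (⟪x i, a⟫_ℂ).re ≤ r * ‖a‖ := fun i hi => by
      have h := re_inner_le_norm (𝕜 := ℂ) (x i) a
      rw [RCLike.re_to_complex, hnorm i hi] at h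
      exact h
    have hsum : ∑ i ∈ s, (⟪x i, a⟫_ℂ).re = ∑ _i ∈ s, r * ‖a‖ := by
      rw [← Complex.re_sum, ← sum_inner, sum_const, nsmul_eq_mul]
      have : (⟪a, a⟫_ℂ).re = ‖a‖ ^ 2 := by rw [inner_self_eq_norm_sq_to_K]; norm_cast
      rw [this, heq]; ring
    exact (sum_eq_sum_iff_of_le hle').1 hsum
  -- hence `‖a‖ • x i = r • a`
  have hprop : ∀ i ∈ s, (‖a‖ : ℂ) • x i = (r : ℂ) • a := by
    intro i hi
    rw [← sub_eq_zero, ← norm_eq_zero, ← sq_eq_zero_iff, @norm_sub_sq ℂ]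
    rw [norm_smul, norm_smul, Complex.norm_real, Complex.norm_real, Real.norm_eq_abs,
      Real.norm_eq_abs, abs_of_nonneg (norm_nonneg a), abs_of_nonneg hr0, inner_smul_left,
      inner_smul_right, hnorm i hi, RCLike.re_to_complex]
    have : ((starRingEnd ℂ) (‖a‖ : ℂ) * ((r : ℂ) * ⟪x i, a⟫_ℂ)).re = ‖a‖ * (r * (r * ‖a‖)) := by
      rw [Complex.conj_ofReal, Complex.re_ofReal_mul, Complex.re_ofReal_mul, hre i hi]
    rw [this]
    ring
  have hapos : (‖a‖ : ℂ) ≠ 0 := by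
    rw [heq]; exact_mod_cast (mul_pos (by exact_mod_cast card_pos.2 ⟨i₀, hi₀⟩) hrpos).ne'
  have h1 := hprop i₀ hi₀
  have h2 := hprop j₀ hj₀
  rw [← h2] at h1
  exact smul_right_injective V hapos h1

/-- **Integrality through a set of generators**: if `t · z ∈ ℤ` for every element `z` of a set
`S ⊆ ℕ`, then `t · gcd(S) ∈ ℤ` (`Nat.setGcd S` is a `ℤ`-combination of elements of `S`).
[folklore] -/
theorem exists_int_setGcd_mul {S : Set ℕ} {t : ℝ} (h : ∀ z ∈ S, ∃ n : ℤ, (z : ℝ) * t = n) :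
    ∃ n : ℤ, (Nat.setGcd S : ℝ) * t = n := by
  -- the integers `z` with `z t ∈ ℤ` form an ideal of `ℤ`
  let J : Ideal ℤ :=
    { carrier := {z : ℤ | ∃ n : ℤ, (z : ℝ) * t = n}
      add_mem' := by
        rintro a b ⟨n, hn⟩ ⟨m, hm⟩
        exact ⟨n + m, by push_cast; rw [add_mul, hn, hm]⟩
      zero_mem' := ⟨0, by simp⟩
      smul_mem' := by
        rintro c a ⟨n, hn⟩
        exact ⟨c * n, by simp only [smul_eq_mul]; push_cast; rw [mul_assoc, hn]⟩ }
  have hsub : Ideal.span (((↑) : ℕ → ℤ) '' S) ≤ J := by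
    rw [Ideal.span_le]
    rintro _ ⟨z, hz, rfl⟩
    obtain ⟨n, hn⟩ := h z hz
    exact ⟨n, by exact_mod_cast hn⟩
  have hmem : (Nat.setGcd S : ℤ) ∈ J := by
    apply hsub
    rw [← Nat.span_singleton_setGcd]
    exact Ideal.mem_span_singleton_self _
  obtain ⟨n, hn⟩ := hmem
  exact ⟨n, by exact_mod_cast hn⟩

end Helpers

/-! ## `d' > 0` -/

/-- `d'(A) ≠ 0` (it divides `k^d − 1 ≥ 1`). [folklore] -/
theorem transducerDPrime_neZero {σ : Type*} [Fintype σ] [DecidableEq σ] {k : ℕ} (hk : 2 ≤ k)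
    (δ : σ → ℕ → σ) (htriv : ∀ q d, k ≤ d → δ q d = q) : NeZero (transducerDPrime hk δ htriv) := by
  refine ⟨fun h0 => ?_⟩
  have hdvd := transducerDPrime_dvd hk δ htriv
  rw [h0, zero_dvd_iff] at hdvd
  have hd : 0 < transducerPeriod k δ := transducerPeriod_pos (by omega) htriv
  have : 2 ≤ k ^ transducerPeriod k δ := by
    calc 2 ≤ k := hk
      _ = k ^ 1 := (pow_one k).symm
      _ ≤ k ^ transducerPeriod k δ := Nat.pow_le_pow_right (by omega) hd
  omega

namespace MinImage

variable {σ : Type*} [Fintype σ] [DecidableEq σ] {δ : σ → ℕ → σ} {k : ℕ}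
variable {V : Type*} [NormedAddCommGroup V] [InnerProductSpace ℂ V]

/-! ## Classes are trivial when `d = 1` -/

/-- With `d(A) = 1` every length class is `0`. [folklore] -/
theorem class_eq_zero (hd : transducerPeriod k δ = 1) (c : ZMod (transducerPeriod k δ)) : c = 0 := by
  have h : ∀ (n : ℕ) (_ : n = 1) (x : ZMod n), x = 0 := by
    rintro n rfl x; exact Subsingleton.elim _ _
  exact h _ hd c

/-- With `d(A) = 1`, `k^L ≡ 1 (mod d')` for every `L`. [folklore] -/
theorem natCast_pow_eq_one_of_period_eq_one (hk : 2 ≤ k) (htriv : ∀ q d, k ≤ d → δ q d = q)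
    (hd : transducerPeriod k δ = 1) (L : ℕ) :
    ((k ^ L : ℕ) : ZMod (transducerDPrime hk δ htriv)) = 1 :=
  natCast_pow_eq_one_of_dvd hk htriv (by rw [hd]; exact one_dvd _)

/-! ## Reverse paths -/

/-- **Reverse paths** (`d = 1`): every digit path `w : N → N'` is completed to a loop with
trivial output by a digit path `w̄ : N' → N` of any prescribed minimal length.
[cite: Mullner2017, Lemma 2.8] -/
theorem exists_reverse_path (hk : 2 ≤ k) (htriv : ∀ q d, k ≤ d → δ q d = q)
    (hd : transducerPeriod k δ = 1) (N : MinImage δ) {w : List ℕ} (hwd : ∀ d ∈ w, d < k) (L : ℕ) :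
    ∃ wbar : List ℕ, (∀ d ∈ wbar, d < k) ∧ L ≤ wbar.length ∧ (N.next w).next wbar = N ∧
      (N.next w).T wbar = (N.T w).symm := by
  have hk0 : 0 < k := by omega
  obtain ⟨m, hm⟩ := exists_path_of_period_eq_one hk0 htriv hd (δ := δ)
  have hmem : (N.T w).symm ∈ (N.next w).pathOutputs k N (-(w.length : ZMod (transducerPeriod k δ))) :=
    symm_mem_pathOutputs hk0 htriv (T_mem_pathOutputs N hwd)
  obtain ⟨wbar, hd', hl, hn, hT⟩ := hm (N.next w) N _ (max m L) (le_max_left _ _) _ hmem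
  exact ⟨wbar, hd', by rw [hl]; exact le_max_right _ _, hn, hT⟩

/-! ## `s₀` is invariant under conjugation along paths -/

/-- **Conjugation invariance of `s₀` along paths** (`d = k₀ = 1`): for a digit path `w : N → N'`
and `g' ∈ G_{N'}`, `s₀^{N}(T(N,w) ≫ g' ≫ T(N,w)⁻¹) = s₀^{N'}(g')` — both are the residue of the
loop `w u' w̄` resp. `u'` modulo `d'`, and `[w] + [w̄] ≡ s₀(id) = 0`.
[cite: Mullner2017, Thm. 2.16 / Prop. 2.23] -/
theorem s0_conj_path (hk : 2 ≤ k) (htriv : ∀ q d, k ≤ d → δ q d = q)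
    (hd : transducerPeriod k δ = 1) (hk0 : transducerK0 hk δ htriv = 1)
    (N : MinImage δ) {w : List ℕ} (hwd : ∀ d ∈ w, d < k) {g' : Equiv.Perm (Fin (minRank δ))}
    (hg' : g' ∈ (N.next w).loopGroup (by omega : 0 < k) htriv) :
    N.s0 hk htriv ((N.T w).trans (g'.trans (N.T w).symm)) = (N.next w).s0 hk htriv g' := by
  set L := s0Level hk htriv (δ := δ) with hL
  -- a loop `u'` at `N'` realising `g'`, of length `L`
  obtain ⟨u', hu'd, hu'l, hu'n, hu'T⟩ := (s0_spec hk htriv (δ := δ)).2.1 (N.next w) L le_rfl g' hg'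
  rw [hd, mul_one] at hu'l
  -- a reverse path of length `≥ L`
  obtain ⟨wbar, hbd, hbl, hbn, hbT⟩ := N.exists_reverse_path hk htriv hd hwd L
  -- the two loops at `N`
  have hWd : ∀ d ∈ w ++ u' ++ wbar, d < k := by
    intro d hd'
    simp only [List.mem_append] at hd'
    rcases hd' with (h | h) | h
    exacts [hwd d h, hu'd d h, hbd d h]
  have hW₀d : ∀ d ∈ w ++ wbar, d < k := by
    intro d hd'
    rcases List.mem_append.1 hd' with h | h
    exacts [hwd d h, hbd d h]
  have hWn : N.next (w ++ u' ++ wbar) = N := by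
    rw [next_append, next_append, hu'n, hbn]
  have hW₀n : N.next (w ++ wbar) = N := by rw [next_append, hbn]
  have hWT : N.T (w ++ u' ++ wbar) = (N.T w).trans (g'.trans (N.T w).symm) := by
    rw [T_append, T_append, next_append, hu'n, hu'T, hbT, Equiv.trans_assoc]
  have hW₀T : N.T (w ++ wbar) = 1 := by
    rw [T_append, hbT, Equiv.self_trans_symm]; rfl
  have hWlen : (w ++ u' ++ wbar).length = (w ++ u' ++ wbar).length * transducerPeriod k δ := by
    rw [hd, mul_one]
  have hW₀len : (w ++ wbar).length = (w ++ wbar).length * transducerPeriod k δ := by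
    rw [hd, mul_one]
  have hWge : L ≤ (w ++ u' ++ wbar).length := by
    simp only [List.length_append]; omega
  have hW₀ge : L ≤ (w ++ wbar).length := by
    simp only [List.length_append]; omega
  have e1 := N.natCast_wordVal_loop_of_k0 hk htriv hk0 hWd hWlen hWn hWge
  have e2 := N.natCast_wordVal_loop_of_k0 hk htriv hk0 hW₀d hW₀len hW₀n hW₀ge
  have e3 := (N.next w).natCast_wordVal_loop_of_k0 hk htriv hk0 hu'd
    (by rw [hu'l, hd, mul_one]) hu'n le_rfl
  rw [hWT] at e1
  rw [hW₀T, s0_one] at e2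
  rw [hu'T] at e3
  rw [← e1, ← e3]
  -- residues of concatenations
  simp only [wordVal_append, Nat.cast_add, Nat.cast_mul,
    natCast_pow_eq_one_of_period_eq_one hk htriv hd, mul_one] at e2 ⊢
  linear_combination e2

/-! ## The relabelled loop outputs and the special characters -/

/-- The relabelled output of a loop with plain output `g` at `N`: `ρ_N⁻¹ ≫ g ≫ ρ_N`
(`MinImage.Tρ` of a loop). [cite: Mullner2017, Prop. 2.6] -/
def conjρ (ρ : MinImage δ → Equiv.Perm (Fin (minRank δ))) (N : MinImage δ)
    (g : Equiv.Perm (Fin (minRank δ))) : Equiv.Perm (Fin (minRank δ)) :=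
  ((ρ N).symm.trans g).trans (ρ N)

/-- `T̄` of a loop is the conjugate of its plain output. [folklore] -/
theorem Tρ_eq_conjρ (ρ : MinImage δ → Equiv.Perm (Fin (minRank δ))) (N : MinImage δ) {w : List ℕ}
    (hw : N.next w = N) : N.Tρ ρ w = conjρ ρ N (N.T w) := by
  rw [Tρ, conjρ, rho_congr ρ hw]

/-- `conjρ` as a product in `Perm`. [folklore] -/
theorem conjρ_eq_mul (ρ : MinImage δ → Equiv.Perm (Fin (minRank δ))) (N : MinImage δ)
    (g : Equiv.Perm (Fin (minRank δ))) : conjρ ρ N g = ρ N * g * (ρ N)⁻¹ := by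
  rw [conjρ, Equiv.Perm.mul_def, Equiv.Perm.mul_def, Equiv.Perm.inv_def, Equiv.trans_assoc]

/-- `conjρ` of the identity. [folklore] -/
theorem conjρ_one (ρ : MinImage δ → Equiv.Perm (Fin (minRank δ))) (N : MinImage δ) :
    conjρ ρ N 1 = 1 := by
  rw [conjρ_eq_mul, mul_one, mul_inv_cancel]

/-- `T̄` as a product in `Perm`: `T̄(N, w) = ρ_{N'} · T(N, w) · ρ_N⁻¹`. [folklore] -/
theorem Tρ_eq_mul (ρ : MinImage δ → Equiv.Perm (Fin (minRank δ))) (N : MinImage δ) (w : List ℕ) :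
    N.Tρ ρ w = ρ (N.next w) * N.T w * (ρ N)⁻¹ := by
  rw [Tρ, Equiv.Perm.mul_def, Equiv.Perm.mul_def, Equiv.Perm.inv_def, Equiv.trans_assoc]

/-- The special character `D_ℓ` at the state `N`: `D_ℓ(g) = e(ℓ s₀(g) / d')`.
[cite: Mullner2017, §2.4 (the representations D_ℓ)] -/
def loopChar (hk : 2 ≤ k) (htriv : ∀ q d, k ≤ d → δ q d = q) [NeZero (transducerDPrime hk δ htriv)]
    (N : MinImage δ) (ℓ : ZMod (transducerDPrime hk δ htriv)) (g : Equiv.Perm (Fin (minRank δ))) : ℂ :=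
  ZMod.stdAddChar (ℓ * N.s0 hk htriv g)

/-- **The `D_ℓ`-eigenspace at `N`**: vectors on which every relabelled loop output at `N` acts
through the character `D_ℓ`. [cite: Mullner2017, Thm. 4.5 (the excluded representations)] -/
def charSubspace (hk : 2 ≤ k) (htriv : ∀ q d, k ≤ d → δ q d = q) [NeZero (transducerDPrime hk δ htriv)]
    (A : Equiv.Perm (Fin (minRank δ)) →* (V →ₗ[ℂ] V)) (ρ : MinImage δ → Equiv.Perm (Fin (minRank δ)))
    (N : MinImage δ) (ℓ : ZMod (transducerDPrime hk δ htriv)) : Submodule ℂ V where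
  carrier := {v | ∀ g ∈ N.loopGroup (by omega : 0 < k) htriv,
    A (conjρ ρ N g) v = N.loopChar hk htriv ℓ g • v}
  add_mem' := by
    intro a b ha hb g hg
    rw [map_add, ha g hg, hb g hg, smul_add]
  zero_mem' := by
    intro g _; rw [map_zero, smul_zero]
  smul_mem' := by
    intro c a ha g hg
    show A (conjρ ρ N g) (c • a) = N.loopChar hk htriv ℓ g • c • a
    rw [map_smul, ha g hg, smul_comm]

/-- Membership in `charSubspace`. [folklore] -/
theorem mem_charSubspace {hk : 2 ≤ k} {htriv : ∀ q d, k ≤ d → δ q d = q}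
    [NeZero (transducerDPrime hk δ htriv)] {A : Equiv.Perm (Fin (minRank δ)) →* (V →ₗ[ℂ] V)}
    {ρ : MinImage δ → Equiv.Perm (Fin (minRank δ))} {N : MinImage δ}
    {ℓ : ZMod (transducerDPrime hk δ htriv)} {v : V} :
    v ∈ N.charSubspace hk htriv A ρ ℓ ↔
      ∀ g ∈ N.loopGroup (by omega : 0 < k) htriv, A (conjρ ρ N g) v = N.loopChar hk htriv ℓ g • v :=
  Iff.rfl

/-- **The bad subspace at `N`**: the span of the `D_ℓ`-eigenspaces, `ℓ ∈ ℤ/d'ℤ`.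
[cite: Mullner2017, Thm. 4.5] -/
def badSubspace (hk : 2 ≤ k) (htriv : ∀ q d, k ≤ d → δ q d = q) [NeZero (transducerDPrime hk δ htriv)]
    (A : Equiv.Perm (Fin (minRank δ)) →* (V →ₗ[ℂ] V)) (ρ : MinImage δ → Equiv.Perm (Fin (minRank δ)))
    (N : MinImage δ) : Submodule ℂ V :=
  ⨆ ℓ, N.charSubspace hk htriv A ρ ℓ

/-- **The good subspace at `N`**: the orthogonal complement of the bad one (the sum of the
isotypic components of `A|_{G_N}` of the representations OTHER than `D_0, …, D_{d'-1}`).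
[cite: Mullner2017, Thm. 4.5] -/
def goodSubspace (hk : 2 ≤ k) (htriv : ∀ q d, k ≤ d → δ q d = q) [NeZero (transducerDPrime hk δ htriv)]
    (A : Equiv.Perm (Fin (minRank δ)) →* (V →ₗ[ℂ] V)) (ρ : MinImage δ → Equiv.Perm (Fin (minRank δ)))
    (N : MinImage δ) : Submodule ℂ V :=
  (N.badSubspace hk htriv A ρ)ᗮ

/-- `charSubspace ≤ badSubspace`. [folklore] -/
theorem charSubspace_le_badSubspace (hk : 2 ≤ k) (htriv : ∀ q d, k ≤ d → δ q d = q)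
    [NeZero (transducerDPrime hk δ htriv)] (A : Equiv.Perm (Fin (minRank δ)) →* (V →ₗ[ℂ] V))
    (ρ : MinImage δ → Equiv.Perm (Fin (minRank δ))) (N : MinImage δ)
    (ℓ : ZMod (transducerDPrime hk δ htriv)) :
    N.charSubspace hk htriv A ρ ℓ ≤ N.badSubspace hk htriv A ρ :=
  le_iSup (fun ℓ => N.charSubspace hk htriv A ρ ℓ) ℓ

/-- A good vector lying in some `D_ℓ`-eigenspace vanishes. [folklore] -/
theorem eq_zero_of_mem_good_of_mem_char {hk : 2 ≤ k} {htriv : ∀ q d, k ≤ d → δ q d = q}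
    [NeZero (transducerDPrime hk δ htriv)] {A : Equiv.Perm (Fin (minRank δ)) →* (V →ₗ[ℂ] V)}
    {ρ : MinImage δ → Equiv.Perm (Fin (minRank δ))} {N : MinImage δ}
    {ℓ : ZMod (transducerDPrime hk δ htriv)} {y : V} (hy : y ∈ N.goodSubspace hk htriv A ρ)
    (hyℓ : y ∈ N.charSubspace hk htriv A ρ ℓ) : y = 0 := by
  have h := (Submodule.mem_orthogonal _ y).1 hy y (charSubspace_le_badSubspace hk htriv A ρ N ℓ hyℓ)
  exact inner_self_eq_zero.1 h

/-! ## Invariance along paths -/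

/-- The conjugate of a loop at `N'` by a path `N → N'` is a loop at `N`. [folklore] -/
theorem conj_mem_loopGroup (hk : 2 ≤ k) (htriv : ∀ q d, k ≤ d → δ q d = q) (N : MinImage δ)
    {w : List ℕ} (hwd : ∀ d ∈ w, d < k) {g' : Equiv.Perm (Fin (minRank δ))}
    (hg' : g' ∈ (N.next w).loopGroup (by omega : 0 < k) htriv) :
    (N.T w).trans (g'.trans (N.T w).symm) ∈ N.loopGroup (by omega : 0 < k) htriv := by
  have hk0 : 0 < k := by omega
  have h1 : N.T w ∈ N.pathOutputs k (N.next w) (w.length : ZMod (transducerPeriod k δ)) :=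
    T_mem_pathOutputs N hwd
  have h2 := symm_mem_pathOutputs hk0 htriv h1
  have h3 := trans_mem_pathOutputs (mem_loopGroup.1 hg') h2
  have h4 := trans_mem_pathOutputs h1 h3
  rw [zero_add, add_neg_cancel] at h4
  exact mem_loopGroup.2 h4

/-- **The `D_ℓ`-eigenspaces are carried along paths**: `A(T̄(N, w))` maps `charSubspace N ℓ`
into `charSubspace δ(N,w) ℓ`. [cite: Mullner2017, Thm. 4.5 (proof structure)] -/
theorem A_Tρ_mem_charSubspace (hk : 2 ≤ k) (htriv : ∀ q d, k ≤ d → δ q d = q)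
    [NeZero (transducerDPrime hk δ htriv)] (hd : transducerPeriod k δ = 1)
    (hk0 : transducerK0 hk δ htriv = 1) (A : Equiv.Perm (Fin (minRank δ)) →* (V →ₗ[ℂ] V))
    (ρ : MinImage δ → Equiv.Perm (Fin (minRank δ))) (N : MinImage δ) {w : List ℕ}
    (hwd : ∀ d ∈ w, d < k) {ℓ : ZMod (transducerDPrime hk δ htriv)} {v : V}
    (hv : v ∈ N.charSubspace hk htriv A ρ ℓ) :
    A (N.Tρ ρ w) v ∈ (N.next w).charSubspace hk htriv A ρ ℓ := by
  intro g' hg'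
  set h := N.T w with hh
  have hX : h.trans (g'.trans h.symm) ∈ N.loopGroup (by omega : 0 < k) htriv :=
    N.conj_mem_loopGroup hk htriv hwd hg'
  -- the permutation identity
  have hperm : conjρ ρ (N.next w) g' * N.Tρ ρ w = N.Tρ ρ w * conjρ ρ N (h.trans (g'.trans h.symm)) := by
    rw [hh]
    exact Equiv.ext fun x => by simp [conjρ, Tρ, Equiv.Perm.mul_apply]
  have e1 : A (conjρ ρ (N.next w) g') (A (N.Tρ ρ w) v) =
      A (N.Tρ ρ w) (A (conjρ ρ N (h.trans (g'.trans h.symm))) v) := by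
    rw [← Module.End.mul_apply, ← map_mul, hperm, map_mul, Module.End.mul_apply]
  rw [e1, hv _ hX, map_smul, loopChar, loopChar, N.s0_conj_path hk htriv hd hk0 hwd hg']

/-- Inner products are preserved by a norm-preserving representation. [folklore] -/
theorem inner_A_A {A : Equiv.Perm (Fin (minRank δ)) →* (V →ₗ[ℂ] V)} (hA : ∀ g v, ‖A g v‖ = ‖v‖)
    (g : Equiv.Perm (Fin (minRank δ))) (v w : V) : ⟪A g v, A g w⟫_ℂ = ⟪v, w⟫_ℂ :=
  (⟨A g, hA g⟩ : V →ₗᵢ[ℂ] V).inner_map_map v w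

/-- **The good subspaces are carried along paths**: `A(T̄(N, w))` maps `goodSubspace N` into
`goodSubspace δ(N,w)` (unitarity and a reverse path). [cite: Mullner2017, Thm. 4.5 (proof structure)] -/
theorem A_Tρ_mem_goodSubspace (hk : 2 ≤ k) (htriv : ∀ q d, k ≤ d → δ q d = q)
    [NeZero (transducerDPrime hk δ htriv)] (hd : transducerPeriod k δ = 1)
    (hk0 : transducerK0 hk δ htriv = 1) (A : Equiv.Perm (Fin (minRank δ)) →* (V →ₗ[ℂ] V))
    (hA : ∀ g v, ‖A g v‖ = ‖v‖) (ρ : MinImage δ → Equiv.Perm (Fin (minRank δ))) (N : MinImage δ)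
    {w : List ℕ} (hwd : ∀ d ∈ w, d < k) {y : V} (hy : y ∈ N.goodSubspace hk htriv A ρ) :
    A (N.Tρ ρ w) y ∈ (N.next w).goodSubspace hk htriv A ρ := by
  rw [goodSubspace, Submodule.mem_orthogonal]
  intro u hu
  -- a reverse path with trivial total output
  obtain ⟨wbar, hbd, -, hbn, hbT⟩ := N.exists_reverse_path hk htriv hd hwd 0
  have hloop : N.Tρ ρ (w ++ wbar) = 1 := by
    rw [Tρ_eq_mul, T_append, hbT, Equiv.self_trans_symm, next_append, hbn]
    rw [show (Equiv.refl (Fin (minRank δ)) : Equiv.Perm (Fin (minRank δ))) = 1 from rfl, mul_one,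
      mul_inv_cancel]
  have hprod : (N.next w).Tρ ρ wbar * N.Tρ ρ w = 1 := by
    rw [← hloop, Tρ_append, Equiv.Perm.mul_def]
  -- transport `u` back to `N`
  induction hu using Submodule.iSup_induction' with
  | mem ℓ u hu =>
    have hu' : A ((N.next w).Tρ ρ wbar) u ∈ N.charSubspace hk htriv A ρ ℓ := by
      have := (N.next w).A_Tρ_mem_charSubspace hk htriv hd hk0 A ρ hbd hu
      rwa [hbn] at this
    have h0 := (Submodule.mem_orthogonal _ y).1 hy _ (charSubspace_le_badSubspace hk htriv A ρ N ℓ hu')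
    rw [← inner_A_A hA ((N.next w).Tρ ρ wbar), ← Module.End.mul_apply, ← map_mul, hprod, map_one,
      Module.End.one_apply] 
    exact h0
  | zero => exact inner_zero_left _
  | add u u' _ _ ihu ihu' => rw [inner_add_left, ihu, ihu', add_zero]

/-! ## Loops of a fixed length, as numbers -/

/-- `loopBlock k m N`: the numbers `ε < k^m` whose padded block `(ε)_k^m` is a loop at `N`.
[cite: Mullner2017, Lemma 4.8 (the words w_g)] -/
def loopBlock (k m : ℕ) (N : MinImage δ) : Finset ℕ :=
  (range (k ^ m)).filter fun ε => N.next (msbBlock k m ε) = N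

/-- Membership in `loopBlock`. [folklore] -/
theorem mem_loopBlock {m : ℕ} {N : MinImage δ} {ε : ℕ} :
    ε ∈ loopBlock k m N ↔ ε < k ^ m ∧ N.next (msbBlock k m ε) = N := by
  simp [loopBlock]

/-- A digit loop of length `m` at `N` is (the block of) an element of `loopBlock k m N`. [folklore] -/
theorem wordVal_mem_loopBlock (hk : 2 ≤ k) {m : ℕ} {N : MinImage δ} {w : List ℕ}
    (hwd : ∀ d ∈ w, d < k) (hwl : w.length = m) (hwn : N.next w = N) :
    wordVal k w ∈ loopBlock k m N ∧ msbBlock k m (wordVal k w) = w := by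
  have hk1 : 1 < k := hk
  have hblock : msbBlock k m (wordVal k w) = w := by
    rw [← hwl]; exact msbBlock_ofDigits_reverse hk1 hwd
  refine ⟨mem_loopBlock.2 ⟨?_, by rw [hblock, hwn]⟩, hblock⟩
  have h := Nat.ofDigits_lt_base_pow_length hk1 (fun x hx => hwd x (List.mem_reverse.1 hx))
  rwa [List.length_reverse, hwl] at h

/-- The block of an element of `loopBlock` is a digit loop of length `m` with number `ε`. [folklore] -/
theorem loopBlock_spec (hk : 2 ≤ k) {m : ℕ} {N : MinImage δ} {ε : ℕ} (hε : ε ∈ loopBlock k m N) :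
    (∀ d ∈ msbBlock k m ε, d < k) ∧ (msbBlock k m ε).length = m ∧ N.next (msbBlock k m ε) = N ∧
      wordVal k (msbBlock k m ε) = ε := by
  have hk1 : 1 < k := hk
  obtain ⟨hlt, hn⟩ := mem_loopBlock.1 hε
  exact ⟨fun d hd => lt_of_mem_msbBlock hk1 hd, length_msbBlock hk1 hlt, hn,
    ofDigits_reverse_msbBlock k m ε⟩

/-- **`k₀ = 1`, `d = 1`: the number of a loop is `s₀` of its output** (every loop of length
`≥ ℓ*`). [cite: Mullner2017, Thm. 2.16] -/
theorem natCast_wordVal_eq_s0 (hk : 2 ≤ k) (htriv : ∀ q d, k ≤ d → δ q d = q)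
    (hd : transducerPeriod k δ = 1) (hk0 : transducerK0 hk δ htriv = 1) (N : MinImage δ)
    {w : List ℕ} (hwd : ∀ d ∈ w, d < k) (hwn : N.next w = N)
    (hwl : s0Level hk htriv (δ := δ) ≤ w.length) :
    ((wordVal k w : ℕ) : ZMod (transducerDPrime hk δ htriv)) = N.s0 hk htriv (N.T w) :=
  N.natCast_wordVal_loop_of_k0 hk htriv hk0 hwd (by rw [hd, mul_one]) hwn hwl

/-- The loop sum at `N`: `S_N(t) y = ∑_{ε ∈ loopBlock} e(−εt) · A(T̄(N, (ε)_k^m)) y`.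
[cite: Mullner2017, Lemma 4.8] -/
def loopSum (k m : ℕ) (A : Equiv.Perm (Fin (minRank δ)) →* (V →ₗ[ℂ] V))
    (ρ : MinImage δ → Equiv.Perm (Fin (minRank δ))) (N : MinImage δ) (t : ℝ) (y : V) : V :=
  ∑ ε ∈ loopBlock k m N, ((𝐞 (-((ε : ℝ) * t)) : Circle) : ℂ) • A (N.Tρ ρ (msbBlock k m ε)) y

/-- **Block data** (`d = 1`): a block length `m = n₁ + L` with `n₁ ≥ ℓ* `, `L ≥ ℓ₀` (the exponent
with `d'' ∣ k^{ℓ₀}`, Thm. 2.16 (2)) and a loop of length exactly `L` at every state.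
[cite: Mullner2017, Lemma 4.9 (the lengths m₀' and ℓ₀)] -/
theorem exists_blockData (hk : 2 ≤ k) (htriv : ∀ q d, k ≤ d → δ q d = q) :
    ∃ m L ℓ₀ : ℕ, 0 < m ∧ L ≤ m ∧ s0Level hk htriv (δ := δ) ≤ m - L ∧ ℓ₀ ≤ L ∧
      (∀ (M M' : MinImage δ) (c : ZMod (transducerPeriod k δ)),
        Nat.gcd (M.limitDiffGcd hk htriv M' c) (k ^ ℓ₀) * M.dPrime hk htriv M' c =
          M.limitDiffGcd hk htriv M' c) ∧
      ∀ N : MinImage δ, ∃ v : List ℕ, (∀ d ∈ v, d < k) ∧ v.length = L ∧ N.next v = N := by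
  obtain ⟨ℓ₀, hℓ₀⟩ := exists_dPrime_mul_gcd hk htriv (δ := δ)
  obtain ⟨N₀, hN₀⟩ := exists_forall_exists_next_eq (by omega : 0 < k) htriv (δ := δ)
  refine ⟨s0Level hk htriv (δ := δ) + 1 + max ℓ₀ N₀, max ℓ₀ N₀, ℓ₀, by omega, by omega, by omega,
    le_max_left _ _, hℓ₀, fun N => ?_⟩
  obtain ⟨v, hvd, hvl, hvn⟩ := hN₀ N N (max ℓ₀ N₀) (le_max_right _ _)
  exact ⟨v, hvd, hvl, hvn⟩

/-- `e(-x) · e(x) = 1`. [folklore] -/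
theorem fourierChar_neg_mul_self' (x : ℝ) : ((𝐞 (-x) : Circle) : ℂ) * ((𝐞 x : Circle) : ℂ) = 1 := by
  rw [← fourierChar_coe_add, neg_add_cancel]
  simp

/-- **The arithmetic of Lemma 4.9**: if `D t = a ∈ ℤ` with `D = d'' d'`, `gcd(d'', d') = 1`, and
`Δ` is a multiple of `d'' κ`, then `e(Δ t) = e((a d''⁻¹ Δ) / d')` as a character of `ℤ/d'ℤ`.
[cite: Mullner2017, Lemma 4.9 (second estimate)] -/
theorem fourierChar_mul_eq_stdAddChar {D d' d'' κ : ℕ} [NeZero d'] (hD : D = d'' * d')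
    (hD0 : 0 < D) (hcop : Nat.Coprime d'' d') {a : ℤ} {t : ℝ} (ht : (D : ℝ) * t = a) {Δ X : ℤ}
    (hΔ : Δ = X * ((d'' * κ : ℕ) : ℤ)) :
    ((𝐞 ((Δ : ℝ) * t) : Circle) : ℂ) =
      ZMod.stdAddChar (N := d') ((a : ZMod d') * ((d'' : ZMod d'))⁻¹ * (Δ : ZMod d')) := by
  have hd''0 : (d'' : ℝ) ≠ 0 := by
    have hpos : 0 < d'' := Nat.pos_of_ne_zero fun h => by rw [h, zero_mul] at hD; omega
    exact_mod_cast hpos.ne'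
  have hd'0 : (d' : ℝ) ≠ 0 := by exact_mod_cast (NeZero.ne d')
  -- `Δ t = (X κ a) / d'`
  have hval : (Δ : ℝ) * t = ((X * κ * a : ℤ) : ℝ) / d' := by
    have ht' : t = a / D := by
      field_simp [show (D : ℝ) ≠ 0 by exact_mod_cast hD0.ne'] at ht ⊢
      linarith
    rw [ht', hΔ, hD]
    push_cast
    field_simp
  rw [hval, fourierChar_int_div]
  congr 1
  -- the residues
  have hinv : ((d'' : ZMod d')) * ((d'' : ZMod d'))⁻¹ = 1 := ZMod.coe_mul_inv_eq_one d'' hcop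
  have e1 : ((Δ : ℤ) : ZMod d') = (X : ZMod d') * (d'' : ZMod d') * (κ : ZMod d') := by
    rw [hΔ]; push_cast; ring
  rw [e1]
  push_cast
  linear_combination (-((X : ZMod d') * (κ : ZMod d') * (a : ZMod d'))) * hinv

/-- **Representatives with a common suffix**: with block data as above and a loop `v` of length
`L` at `N`, every `g ∈ G_N` is the output of the block of some `ε = a k^L + [v]_k ∈ loopBlock`.
[cite: Mullner2017, Lemma 4.8 / Thm. 2.7 (2)] -/
theorem exists_rep (hk : 2 ≤ k) (htriv : ∀ q d, k ≤ d → δ q d = q) (hd : transducerPeriod k δ = 1)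
    {m L : ℕ} (hLm : L ≤ m) (hsm : s0Level hk htriv (δ := δ) ≤ m - L) (N : MinImage δ)
    {v : List ℕ} (hvd : ∀ d ∈ v, d < k) (hvl : v.length = L) (hvn : N.next v = N)
    {g : Equiv.Perm (Fin (minRank δ))} (hg : g ∈ N.loopGroup (by omega : 0 < k) htriv) :
    ∃ ε ∈ loopBlock k m N, N.T (msbBlock k m ε) = g ∧ ∃ a : ℕ, ε = a * k ^ L + wordVal k v := by
  have hk0 : 0 < k := by omega
  have hvT : N.T v ∈ N.loopGroup hk0 htriv := T_mem_loopGroup hvd hvn (by rw [hd]; exact one_dvd _)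
  have hmem : (N.T v)⁻¹ * g ∈ N.loopGroup hk0 htriv := Subgroup.mul_mem _ (Subgroup.inv_mem _ hvT) hg
  obtain ⟨u, hud, hul, hun, huT⟩ := (s0_spec hk htriv (δ := δ)).2.1 N (m - L) hsm _ hmem
  rw [hd, mul_one] at hul
  have hwd : ∀ d ∈ u ++ v, d < k := by
    intro d hd'
    rcases List.mem_append.1 hd' with h | h
    exacts [hud d h, hvd d h]
  have hwl : (u ++ v).length = m := by rw [List.length_append, hul, hvl]; omega
  have hwn : N.next (u ++ v) = N := by rw [next_append, hun, hvn]
  obtain ⟨hmemW, hblock⟩ := wordVal_mem_loopBlock hk hwd hwl hwn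
  refine ⟨wordVal k (u ++ v), hmemW, ?_, wordVal k u, by rw [wordVal_append, hvl]⟩
  rw [hblock, T_append, hun, huT, ← Equiv.Perm.mul_def, mul_inv_cancel_left]

/-- **The strict inequality** (Lemmas 4.8 and 4.9 merged): for a non-zero good vector `y` the
terms `e(−εt) · A(T̄(N,(ε)_k^m)) y`, `ε ∈ loopBlock k m N`, are not all equal — otherwise `y` is a
common eigenvector with a character that the identity loops (`d(q,q) t ∈ ℤ`), the common suffix
(`d'' ∣ k^L`) and `[w] ≡ s₀(T(q,w)) (mod d')` force to be some `D_ℓ`.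
[cite: Mullner2017, Lemmas 4.8, 4.9] -/
theorem exists_ne_of_mem_good (hk : 2 ≤ k) (htriv : ∀ q d, k ≤ d → δ q d = q)
    [NeZero (transducerDPrime hk δ htriv)] (hd : transducerPeriod k δ = 1)
    (hk0 : transducerK0 hk δ htriv = 1) (A : Equiv.Perm (Fin (minRank δ)) →* (V →ₗ[ℂ] V))
    (ρ : MinImage δ → Equiv.Perm (Fin (minRank δ))) {m L ℓ₀ : ℕ} (hLm : L ≤ m)
    (hsm : s0Level hk htriv (δ := δ) ≤ m - L) (hℓ₀ : ℓ₀ ≤ L)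
    (hgcd : ∀ (M M' : MinImage δ) (c : ZMod (transducerPeriod k δ)),
      Nat.gcd (M.limitDiffGcd hk htriv M' c) (k ^ ℓ₀) * M.dPrime hk htriv M' c = M.limitDiffGcd hk htriv M' c)
    (N : MinImage δ) {v : List ℕ} (hvd : ∀ d ∈ v, d < k) (hvl : v.length = L) (hvn : N.next v = N)
    {y : V} (hy : y ∈ N.goodSubspace hk htriv A ρ) (hy0 : y ≠ 0) (t : ℝ) :
    ∃ ε₁ ∈ loopBlock k m N, ∃ ε₂ ∈ loopBlock k m N,
      ((𝐞 (-((ε₁ : ℝ) * t)) : Circle) : ℂ) • A (N.Tρ ρ (msbBlock k m ε₁)) y ≠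
        ((𝐞 (-((ε₂ : ℝ) * t)) : Circle) : ℂ) • A (N.Tρ ρ (msbBlock k m ε₂)) y := by
  have hk0' : 0 < k := by omega
  by_contra hall
  push Not at hall
  apply hy0
  have hsm' : s0Level hk htriv (δ := δ) ≤ m := hsm.trans (Nat.sub_le _ _)
  -- the term at an element of `loopBlock` with plain output `g`
  have hterm : ∀ ε ∈ loopBlock k m N, A (N.Tρ ρ (msbBlock k m ε)) y =
      A (conjρ ρ N (N.T (msbBlock k m ε))) y := by
    intro ε hε
    rw [Tρ_eq_conjρ ρ N (mem_loopBlock.1 hε).2]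
  -- residues of elements of `loopBlock`
  have hres : ∀ ε ∈ loopBlock k m N,
      ((ε : ℕ) : ZMod (transducerDPrime hk δ htriv)) = N.s0 hk htriv (N.T (msbBlock k m ε)) := by
    intro ε hε
    obtain ⟨hdig, hlen, hnext, hval⟩ := loopBlock_spec hk hε
    have := N.natCast_wordVal_eq_s0 hk htriv hd hk0 hdig hnext (by rw [hlen]; exact hsm')
    rwa [hval] at this
  -- the representative of the identity
  obtain ⟨ε₁, hε₁, hT₁, a₁, ha₁⟩ := N.exists_rep hk htriv hd hLm hsm hvd hvl hvn (Subgroup.one_mem _)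
  have hterm₁ : A (N.Tρ ρ (msbBlock k m ε₁)) y = y := by
    rw [hterm ε₁ hε₁, hT₁, conjρ_one, map_one, Module.End.one_apply]
  -- Step 1: every `g ∈ G_N` acts on `y` by the scalar `e((ε_g − ε₁) t)`
  have heig : ∀ ε ∈ loopBlock k m N,
      A (conjρ ρ N (N.T (msbBlock k m ε))) y = ((𝐞 ((((ε : ℤ) - ε₁ : ℤ) : ℝ) * t) : Circle) : ℂ) • y := by
    intro ε hε
    have h := hall ε hε ε₁ hε₁
    rw [hterm₁, hterm ε hε] at h
    have hc : ((𝐞 (-((ε : ℝ) * t)) : Circle) : ℂ) ≠ 0 := by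
      rw [← norm_ne_zero_iff, norm_fourierChar_coe]; exact one_ne_zero
    have h2 := congrArg (fun z => ((𝐞 ((ε : ℝ) * t) : Circle) : ℂ) • z) h
    simp only [smul_smul] at h2
    rw [mul_comm, fourierChar_neg_mul_self', one_smul] at h2
    rw [h2, ← fourierChar_coe_add]
    congr 2
    push_cast; ring
  -- Step 2: identity loops give `d(q,q) t ∈ ℤ`
  set D := N.limitDiffGcd hk htriv N 0 with hD
  have h1mem : (1 : Equiv.Perm (Fin (minRank δ))) ∈ N.pathOutputs k N 0 :=
    mem_loopGroup.1 (Subgroup.one_mem (N.loopGroup hk0' htriv))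
  have hstab : N.diffGcd k N 1 m = D := by
    have := (s0_spec hk htriv (δ := δ)).1 N N 0 1 h1mem m hsm'
    have hm1 : m * transducerPeriod k δ = m := by rw [hd, mul_one]
    rwa [ZMod.val_zero, zero_add, hm1] at this
  have hDt : ∃ a : ℤ, (D : ℝ) * t = a := by
    rw [← hstab]
    refine exists_int_setGcd_mul fun z hz => ?_
    obtain ⟨x, hx, x', hx', hle, rfl⟩ := hz
    obtain ⟨w, hwd, hwl, hwn, hwT, rfl⟩ := hx
    obtain ⟨w', hw'd, hw'l, hw'n, hw'T, rfl⟩ := hx'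
    obtain ⟨hW, hWb⟩ := wordVal_mem_loopBlock hk hwd hwl hwn
    obtain ⟨hW', hW'b⟩ := wordVal_mem_loopBlock hk hw'd hw'l hw'n
    have e := heig _ hW
    have e' := heig _ hW'
    rw [hWb, hwT, conjρ_one, map_one, Module.End.one_apply] at e
    rw [hW'b, hw'T, conjρ_one, map_one, Module.End.one_apply] at e'
    -- `e(Δ t) y = y = e(Δ' t) y`
    have hinj := smul_left_injective ℂ hy0
    have e1 : ((𝐞 (((((wordVal k w : ℕ) : ℤ) - ε₁ : ℤ) : ℝ) * t) : Circle) : ℂ) = 1 := by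
      apply hinj; simp only [one_smul]; exact e.symm
    have e2 : ((𝐞 (((((wordVal k w' : ℕ) : ℤ) - ε₁ : ℤ) : ℝ) * t) : Circle) : ℂ) = 1 := by
      apply hinj; simp only [one_smul]; exact e'.symm
    have e3 : ((𝐞 (((wordVal k w - wordVal k w' : ℕ) : ℝ) * t) : Circle) : ℂ) = 1 := by
      have : ((wordVal k w - wordVal k w' : ℕ) : ℝ) * t =
          ((((wordVal k w : ℕ) : ℤ) - ε₁ : ℤ) : ℝ) * t + -(((((wordVal k w' : ℕ) : ℤ) - ε₁ : ℤ) : ℝ) * t) := by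
        push_cast [hle]; ring
      rw [this, fourierChar_coe_add, e1, one_mul, AddChar.map_neg_eq_inv, Circle.coe_inv, e2, inv_one]
    obtain ⟨n, hn⟩ := exists_int_of_fourierChar_eq_one e3
    exact ⟨n, hn⟩
  obtain ⟨a, ha⟩ := hDt
  -- Step 3: `D = d'' d'`, `d'' ∣ k^L`, `gcd(d'', d') = 1`
  set d'' := Nat.gcd D (k ^ ℓ₀) with hd''
  have hDeq : D = d'' * transducerDPrime hk δ htriv := by
    have := hgcd N N 0
    rw [N.dPrime_eq_transducerDPrime hk htriv N 0] at this
    exact this.symm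
  have hD0 : 0 < D := N.limitDiffGcd_pos hk htriv N 0
  have hcop : Nat.Coprime d'' (transducerDPrime hk δ htriv) := by
    have h := (coprime_pow_dPrime hk htriv N N 0 ℓ₀).coprime_dvd_left (Nat.gcd_dvd_right D (k ^ ℓ₀))
    rwa [N.dPrime_eq_transducerDPrime hk htriv N 0] at h
  obtain ⟨κ, hκ⟩ : d'' ∣ k ^ L := (Nat.gcd_dvd_right D (k ^ ℓ₀)).trans (pow_dvd_pow k hℓ₀)
  -- Step 4: the character is `D_ℓ` with `ℓ = a d''⁻¹`
  set ℓ : ZMod (transducerDPrime hk δ htriv) :=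
    (a : ZMod (transducerDPrime hk δ htriv)) * ((d'' : ZMod (transducerDPrime hk δ htriv)))⁻¹ with hℓ
  have hchar : y ∈ N.charSubspace hk htriv A ρ ℓ := by
    intro g hg
    obtain ⟨ε, hε, hT, ag, hag⟩ := N.exists_rep hk htriv hd hLm hsm hvd hvl hvn hg
    rw [← hT, heig ε hε, loopChar]
    congr 1
    have hΔ : ((ε : ℤ) - ε₁ : ℤ) = ((ag : ℤ) - a₁) * ((d'' * κ : ℕ) : ℤ) := by
      rw [hag, ha₁, ← hκ]; push_cast; ring
    rw [fourierChar_mul_eq_stdAddChar hDeq hD0 hcop ha hΔ]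
    congr 1
    rw [hℓ]
    have : (((ε : ℤ) - ε₁ : ℤ) : ZMod (transducerDPrime hk δ htriv)) = N.s0 hk htriv (N.T (msbBlock k m ε)) := by
      push_cast
      rw [hres ε hε, hres ε₁ hε₁, hT₁, s0_one, sub_zero]
    rw [this]
  exact eq_zero_of_mem_good_of_mem_char hy hchar

/-! ## The uniform contraction -/

/-- `e` is continuous as a `ℂ`-valued function. [folklore] -/
theorem continuous_fourierChar_coe : Continuous fun x : ℝ => ((𝐞 x : Circle) : ℂ) := by
  have : (fun x : ℝ => ((𝐞 x : Circle) : ℂ)) = fun x : ℝ => Complex.exp (↑(2 * Real.pi * x) * I) :=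
    funext fun x => Real.fourierChar_apply x
  rw [this]
  fun_prop

/-- The loop sum vanishes at `y = 0`. [folklore] -/
theorem loopSum_zero (m : ℕ) (A : Equiv.Perm (Fin (minRank δ)) →* (V →ₗ[ℂ] V))
    (ρ : MinImage δ → Equiv.Perm (Fin (minRank δ))) (N : MinImage δ) (t : ℝ) :
    N.loopSum k m A ρ t 0 = 0 := by
  simp [loopSum]

/-- The loop sum is linear in `y`. [folklore] -/
theorem loopSum_smul (m : ℕ) (A : Equiv.Perm (Fin (minRank δ)) →* (V →ₗ[ℂ] V))
    (ρ : MinImage δ → Equiv.Perm (Fin (minRank δ))) (N : MinImage δ) (t : ℝ) (c : ℂ) (y : V) :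
    N.loopSum k m A ρ t (c • y) = c • N.loopSum k m A ρ t y := by
  simp only [loopSum, map_smul, smul_sum, smul_comm c]

/-- The loop sum is `1`-periodic in `t`. [folklore] -/
theorem loopSum_add_int (m : ℕ) (A : Equiv.Perm (Fin (minRank δ)) →* (V →ₗ[ℂ] V))
    (ρ : MinImage δ → Equiv.Perm (Fin (minRank δ))) (N : MinImage δ) (t : ℝ) (n : ℤ) (y : V) :
    N.loopSum k m A ρ (t + n) y = N.loopSum k m A ρ t y := by
  refine sum_congr rfl fun ε _ => ?_
  congr 1
  have : -((ε : ℝ) * (t + n)) = -((ε : ℝ) * t) + ((-(ε : ℤ) * n : ℤ) : ℝ) := by push_cast; ring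
  rw [this, fourierChar_coe_add, fourierChar_intCast, mul_one]

/-- **The contraction at one state** (compactness in `(t, y)`): with block data as above there is
`η > 0` with `‖S_N(t) y‖ ≤ (#loopBlock − η) ‖y‖` for all real `t` and all good `y`.
[cite: Mullner2017, Lemma 4.8 ("there exists η' > 0 …")] -/
theorem exists_loopSum_gap (hk : 2 ≤ k) (htriv : ∀ q d, k ≤ d → δ q d = q)
    [NeZero (transducerDPrime hk δ htriv)] (hd : transducerPeriod k δ = 1)
    (hk0 : transducerK0 hk δ htriv = 1) (A : Equiv.Perm (Fin (minRank δ)) →* (V →ₗ[ℂ] V))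
    (hA : ∀ g v, ‖A g v‖ = ‖v‖) (ρ : MinImage δ → Equiv.Perm (Fin (minRank δ))) {m L ℓ₀ : ℕ}
    (hLm : L ≤ m) (hsm : s0Level hk htriv (δ := δ) ≤ m - L) (hℓ₀ : ℓ₀ ≤ L)
    (hgcd : ∀ (M M' : MinImage δ) (c : ZMod (transducerPeriod k δ)),
      Nat.gcd (M.limitDiffGcd hk htriv M' c) (k ^ ℓ₀) * M.dPrime hk htriv M' c = M.limitDiffGcd hk htriv M' c)
    (N : MinImage δ) {v : List ℕ} (hvd : ∀ d ∈ v, d < k) (hvl : v.length = L) (hvn : N.next v = N)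
    [FiniteDimensional ℂ V] :
    ∃ η : ℝ, 0 < η ∧ ∀ (t : ℝ) (y : V), y ∈ N.goodSubspace hk htriv A ρ →
      ‖N.loopSum k m A ρ t y‖ ≤ ((loopBlock k m N).card - η) * ‖y‖ := by
  classical
  by_cases hbot : ∀ y ∈ N.goodSubspace hk htriv A ρ, y = 0
  · refine ⟨1, one_pos, fun t y hy => ?_⟩
    rw [hbot y hy, loopSum_zero, norm_zero, mul_zero]
  push Not at hbot
  obtain ⟨y₀, hy₀, hy₀0⟩ := hbot
  haveI : ProperSpace V := FiniteDimensional.proper_rclike ℂ V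
  -- the normalisation map
  have hunit : ∀ y : V, y ≠ 0 → ‖(((‖y‖⁻¹ : ℝ) : ℂ) • y)‖ = 1 := by
    intro y hy
    rw [norm_smul, Complex.norm_real, Real.norm_eq_abs, abs_of_nonneg (inv_nonneg.2 (norm_nonneg _)),
      inv_mul_cancel₀ (norm_ne_zero_iff.2 hy)]
  set C : Set (ℝ × V) :=
    Set.Icc (0 : ℝ) 1 ×ˢ (Metric.sphere (0 : V) 1 ∩ (N.goodSubspace hk htriv A ρ : Set V)) with hC_def
  have hC : IsCompact C :=
    isCompact_Icc.prod ((isCompact_sphere _ _).inter_right (Submodule.closed_of_finiteDimensional _))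
  have hmemC : ∀ (t : ℝ) (y : V), y ∈ N.goodSubspace hk htriv A ρ → y ≠ 0 →
      (Int.fract t, (((‖y‖⁻¹ : ℝ) : ℂ) • y)) ∈ C := by
    intro t y hy hy0
    refine ⟨⟨Int.fract_nonneg t, (Int.fract_lt_one t).le⟩, ?_, Submodule.smul_mem _ _ hy⟩
    rw [mem_sphere_zero_iff_norm, hunit y hy0]
  have hCne : C.Nonempty := ⟨_, hmemC 0 y₀ hy₀ hy₀0⟩
  set f : ℝ × V → ℝ := fun p => ‖N.loopSum k m A ρ p.1 p.2‖ with hf_def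
  have hf : Continuous f := by
    refine continuous_norm.comp ?_
    simp only [loopSum]
    refine continuous_finsetSum _ fun ε _ => ?_
    refine Continuous.smul ?_ ?_
    · exact continuous_fourierChar_coe.comp ((continuous_const.mul continuous_fst).neg)
    · exact (LinearMap.continuous_of_finiteDimensional _).comp continuous_snd
  obtain ⟨p₀, hp₀, hmax⟩ := hC.exists_isMaxOn hCne hf.continuousOn
  obtain ⟨-, hsph, hgood⟩ := hp₀
  have hp₀norm : ‖p₀.2‖ = 1 := mem_sphere_zero_iff_norm.1 hsph
  have hp₀0 : p₀.2 ≠ 0 := by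
    intro h; rw [h, norm_zero] at hp₀norm; exact zero_ne_one hp₀norm
  -- strictness at the maximum
  have hlt : f p₀ < (loopBlock k m N).card := by
    obtain ⟨ε₁, hε₁, ε₂, hε₂, hne⟩ :=
      N.exists_ne_of_mem_good hk htriv hd hk0 A ρ hLm hsm hℓ₀ hgcd hvd hvl hvn hgood hp₀0 p₀.1
    have h := norm_sum_lt_card_mul_of_ne (s := loopBlock k m N) (r := 1)
      (x := fun ε => ((𝐞 (-((ε : ℝ) * p₀.1)) : Circle) : ℂ) • A (N.Tρ ρ (msbBlock k m ε)) p₀.2)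
      (fun ε _ => by rw [norm_smul, norm_fourierChar_coe, one_mul, hA, hp₀norm]) hε₁ hε₂ hne
    rw [mul_one] at h
    exact h
  refine ⟨(loopBlock k m N).card - f p₀, sub_pos.2 hlt, fun t y hy => ?_⟩
  by_cases hy0 : y = 0
  · rw [hy0, loopSum_zero, norm_zero, mul_zero]
  have hle : f (Int.fract t, (((‖y‖⁻¹ : ℝ) : ℂ) • y)) ≤ f p₀ := hmax (hmemC t y hy hy0)
  -- rescale
  have hscale : N.loopSum k m A ρ t y =
      ((‖y‖ : ℝ) : ℂ) • N.loopSum k m A ρ (Int.fract t) (((‖y‖⁻¹ : ℝ) : ℂ) • y) := by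
    rw [loopSum_smul, smul_smul, ← Complex.ofReal_mul, mul_inv_cancel₀ (norm_ne_zero_iff.2 hy0),
      Complex.ofReal_one, one_smul]
    conv_lhs => rw [← Int.fract_add_floor t]
    exact N.loopSum_add_int m A ρ (Int.fract t) ⌊t⌋ y
  rw [hscale, norm_smul, Complex.norm_real, Real.norm_eq_abs, abs_of_nonneg (norm_nonneg _), mul_comm]
  have : f (Int.fract t, (((‖y‖⁻¹ : ℝ) : ℂ) • y)) ≤ (loopBlock k m N).card - ((loopBlock k m N).card - f p₀) := by
    linarith
  exact mul_le_mul_of_nonneg_right this (norm_nonneg _)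

/-- **Müllner's contraction, uniformly over the states** (Lemmas 4.8–4.9 of the paper, for an
arbitrary finite-dimensional unitary representation and the good subspaces; `d = k₀ = 1`):
there are a block length `m ≥ 1` and `0 < η ≤ 1` such that for every state `N`, every real `t`
and every `y ∈ goodSubspace N`,
`‖∑_{ε ∈ loopBlock k m N} e(−εt) · A(T̄(N,(ε)_k^m)) y‖ ≤ (#loopBlock k m N − η) ‖y‖`.
[cite: Mullner2017, Lemmas 4.8, 4.9 (pp. 20–22)] -/
theorem exists_loopSum_contraction (hk : 2 ≤ k) (htriv : ∀ q d, k ≤ d → δ q d = q)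
    [NeZero (transducerDPrime hk δ htriv)] (hd : transducerPeriod k δ = 1)
    (hk0 : transducerK0 hk δ htriv = 1) (A : Equiv.Perm (Fin (minRank δ)) →* (V →ₗ[ℂ] V))
    (hA : ∀ g v, ‖A g v‖ = ‖v‖) (ρ : MinImage δ → Equiv.Perm (Fin (minRank δ)))
    [FiniteDimensional ℂ V] :
    ∃ m : ℕ, 0 < m ∧ ∃ η : ℝ, 0 < η ∧ η ≤ 1 ∧ ∀ (N : MinImage δ) (t : ℝ) (y : V),
      y ∈ N.goodSubspace hk htriv A ρ →
        ‖N.loopSum k m A ρ t y‖ ≤ ((loopBlock k m N).card - η) * ‖y‖ := by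
  classical
  obtain ⟨m, L, ℓ₀, hm0, hLm, hsm, hℓ₀, hgcd, hv⟩ := exists_blockData hk htriv (δ := δ)
  choose v hvd hvl hvn using hv
  choose η hη hgap using fun N : MinImage δ =>
    N.exists_loopSum_gap hk htriv hd hk0 A hA ρ hLm hsm hℓ₀ hgcd (hvd N) (hvl N) (hvn N)
  have hne : (Finset.univ : Finset (MinImage δ)).Nonempty := ⟨transducerBase δ, mem_univ _⟩
  refine ⟨m, hm0, min (Finset.univ.inf' hne η) 1,
    lt_min ((Finset.lt_inf'_iff hne).2 fun N _ => hη N) one_pos, min_le_right _ _,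
    fun N t y hy => (hgap N t y hy).trans ?_⟩
  have h1 : Finset.univ.inf' hne η ≤ η N := Finset.inf'_le η (mem_univ N)
  have h2 : min (Finset.univ.inf' hne η) 1 ≤ η N := (min_le_left _ _).trans h1
  nlinarith [norm_nonneg y]

end MinImage

end Literature.NumberTheory.LFunctions
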